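import Summits.ResolutionOfSingularities.ResolutionOfSingularities.Theorems.EquisingularLiftEquisingularLiftNatVertexExitChartC
import HarnessLib

/-!
# [OURS · L1 W4.5(b) · EL♮] K-VERTEX-EXIT, RIBBON SIDE (N6.1 (c)): the ribbon centres `Z_m` at the K5-VERTEX — `ϖ|_{Z_m} = −h^m`,
# reduced trace `(x̄₃, x̄₁)` on `𝒞`, and the chart `x₃ ≠ 0` of `Bl_{(x̄₃,x̄₁)} 𝒞` is an affine `4`-space
# (crux `EquisingularLiftNat` = stmt-ResolutionOfSingularities-20038; K-∀n / K5-BMY lane, kill test #50)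

HONEST FRAMING. OURS (cell res-hironaka, crux chain w45b, slot W4.5(b)); NOT a statement of any manuscript; replaces the role of
NOTHING in the manuscript; AI-written, AI review is weaker than expert review. Helper `--supports stmt-ResolutionOfSingularities-20038
--as helper`. Sequel of `…NatVertexExitChartC` (p547268: the model `𝒪_𝒞 = k[x₃,c,y₁,x₁,y₂,d]/I₂(N)`, `N = [[x₃,−c,y₁],[x₁,y₂,d]]`); object =
the RIBBON half of res-L1-w45b-strat-1's STRATEGY-CENSUS v11 (sha16 6d78683fc4832623) §4 N6.1 (c), model form — the same species, one band up,
as the global doors (RIB-T)/(RIB-S) of N6.4 (res-L1-w45b-plan-1 READ 2026-08-27T15:30:32Z (b)(c): «one shared ring lemma would serve both bands»).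

N6.1 (c), VERBATIM TARGETS: «an m-RIBBON lift exists for every m ≥ 2 …: C′_m := V(x₃ + cγh^{m−1}, x₁ − y₂γh^{m−1}) …; so ϖ|_{C′_m} = −h^m, C′_m is
regular, (C′_m)_s = m·Σ_{L₁} …, and since h ∈ I_𝒞 the induced ideal on 𝒞 is (z₁, z₂)𝒪_𝒞 = (x₃, x₁)𝒪_𝒞 — REDUCED — so the blow-up is again the
small resolution: chart z₂ = z₁t: St(𝒞) = V(y₂ + ct, d − y₁t) … regular». HERE (γ = 1; `h = m₂₃ = −cd − y₁y₂`; `ϖ := x₁y₁ − x₃d = −m₁₃`):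
* `varpi_add_pow_eq` / `varpi_add_pow_mem` — `ϖ + h^m = y₁·z₂ − d·z₁ ∈ (z₁, z₂)` for `m ≥ 1` (so `ϖ|_{Z_m} = −h^m`: `Z_m` is `O`-flat with
  special fibre `m·Σ_{L₁}`, a ribbon for `m ≥ 2`);
* `mkC_z₁`, `mkC_z₂`, `map_span_z_eq` — for `m ≥ 2` the trace of `Z_m = V(z₁, z₂)` on `𝒞` is `(x̄₃, x̄₁)` (column 1, REDUCED);
* `ψ₁_bijective`, `algebraMap_y₂_eq₁` (`ȳ₂ = −c̄t`), `algebraMap_d_eq₁` (`d̄ = ȳ₁t`), `isRegularRing_B₁` — the chart `x₃ ≠ 0` of the blow-up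
  of `𝒞` along `(x̄₃, x̄₁)` is `k[x₃, c, y₁, t]`, `t = x̄₁/x̄₃` (a domain `k`; regular for a field): the other small resolution of the vertex.
The chart `x₁ ≠ 0` (`s = x̄₃/x̄₁`, graph `c̄ = −ȳ₂s`, `ȳ₁ = d̄s`) is the row-swap `(x₃, c, y₁) ↔ (x₁, y₂, d)` of this one; sequel file.
Model coordinates `X 0,…,X 3 = x₃, c, y₁, t`.

References: res-L1-w45b-strat-1 STRATEGY-CENSUS v11 N6.1 (c); [StacksProject, Tags 052P/052Q/080E]; [GortzWedhorn2020, (13.19) p. 415].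
-/

set_option linter.dupNamespace false -- mandated namespace `Summit.<Summit>.<Problem>` of this single-conjunct summit

noncomputable section

universe u

open Literature.AlgebraicGeometry.Resolution MvPolynomial

namespace Summit.ResolutionOfSingularities.ResolutionOfSingularities.Cruxes.EquisingularLiftNat.Sections

namespace VertexExit

variable (k : Type u) [CommRing k]

/-! # The RIBBON winners at the vertex (N6.1 (c)): `Z_m = V(z₁, z₂)`, `z₁ = x₃ + c·h^{m−1}`, `z₂ = x₁ − y₂·h^{m−1}`, `h = m₂₃`;
# `ϖ|_{Z_m} = −h^m`, the trace on `𝒞` is `(x̄₃, x̄₁)` (column 1), and `Bl_{(x̄₃,x̄₁)} 𝒞` is regular (the other small resolution) -/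

/-- `uε = 1`, `a u = b v` ⇒ `a = b·(vε)`. [folklore] -/
theorem rel_div' {L : Type*} [CommRing L] (a b u v e : L) (he : u * e = 1) (h : a * u = b * v) : a = b * (v * e) := by
  calc a = a * (u * e) := by rw [he, mul_one]
    _ = a * u * e := by ring
    _ = b * v * e := by rw [h]
    _ = b * (v * e) := by ring

/-- `z₁ = x₃ + c·h^{m−1}` (`h = m₂₃ = −cd − y₁y₂`). OURS bookkeeping. -/
def z₁ (m : ℕ) : MvPolynomial (Fin 6) k := X 0 + X 1 * m₂₃ k ^ (m - 1)

/-- `z₂ = x₁ − y₂·h^{m−1}`. OURS bookkeeping. -/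
def z₂ (m : ℕ) : MvPolynomial (Fin 6) k := X 3 - X 4 * m₂₃ k ^ (m - 1)

/-- **`ϖ|_{Z_m} = −h^m`**: `ϖ + h^m = y₁·z₂ − d·z₁ ∈ (z₁, z₂)`, where `ϖ = x₁y₁ − x₃d = −m₁₃` (N6.1 (c) «ϖ|_{C′_m} = −h^m»; so `Z_m` is
`O`-flat with special fibre `m·Σ_{L₁}` — a RIBBON centre for `m ≥ 2`). [folklore] -/
theorem varpi_add_pow_eq (m : ℕ) (hm : 1 ≤ m) :
    (X 3 * X 2 - X 0 * X 5 : MvPolynomial (Fin 6) k) + m₂₃ k ^ m = X 2 * z₂ k m - X 5 * z₁ k m := by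
  obtain ⟨n, rfl⟩ := Nat.exists_eq_add_of_le hm
  rw [z₁, z₂, Nat.add_sub_cancel_left, pow_add, pow_one, m₂₃]
  ring

/-- `ϖ + h^m ∈ (z₁, z₂)`. [folklore] -/
theorem varpi_add_pow_mem (m : ℕ) (hm : 1 ≤ m) :
    (X 3 * X 2 - X 0 * X 5 : MvPolynomial (Fin 6) k) + m₂₃ k ^ m ∈ Ideal.span {z₁ k m, z₂ k m} := by
  rw [varpi_add_pow_eq k m hm]
  exact Ideal.sub_mem _ (Ideal.mul_mem_left _ _ (Ideal.subset_span (by simp)))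
    (Ideal.mul_mem_left _ _ (Ideal.subset_span (by simp)))

/-- `h = m₂₃` vanishes on `𝒞`. [folklore] -/
theorem mkC_m₂₃ : mkC k (m₂₃ k) = 0 :=
  Ideal.Quotient.eq_zero_iff_mem.mpr (Ideal.subset_span (by simp))

/-- **The trace of the ribbon centre on `𝒞` is column 1**: `z̄₁ = x̄₃` in `𝒪_𝒞` for `m ≥ 2`. [folklore] -/
theorem mkC_z₁ (m : ℕ) (hm : 2 ≤ m) : mkC k (z₁ k m) = mkC k (X 0) := by
  obtain ⟨n, rfl⟩ := Nat.exists_eq_add_of_le hm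
  rw [z₁, map_add, map_mul, map_pow, mkC_m₂₃, show 2 + n - 1 = n + 1 by omega, pow_succ, mul_zero, mul_zero, add_zero]

/-- `z̄₂ = x̄₁` in `𝒪_𝒞` for `m ≥ 2`. [folklore] -/
theorem mkC_z₂ (m : ℕ) (hm : 2 ≤ m) : mkC k (z₂ k m) = mkC k (X 3) := by
  obtain ⟨n, rfl⟩ := Nat.exists_eq_add_of_le hm
  rw [z₂, map_sub, map_mul, map_pow, mkC_m₂₃, show 2 + n - 1 = n + 1 by omega, pow_succ, mul_zero, mul_zero, sub_zero]

/-- The trace ideal of the ribbon centre `Z_m` on `𝒞` is `(x̄₃, x̄₁)` — REDUCED, the column-1 ruling `Σ_{L₁}` (N6.1 (c) «the induced ideal on 𝒞 is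
`(z₁, z₂)𝒪_𝒞 = (x₃, x₁)𝒪_𝒞`»). [folklore] -/
theorem map_span_z_eq (m : ℕ) (hm : 2 ≤ m) :
    (Ideal.span {z₁ k m, z₂ k m}).map (mkC k) = Ideal.span {mkC k (X 0), mkC k (X 3)} := by
  rw [Ideal.map_span, Set.image_insert_eq, Set.image_singleton, mkC_z₁ k m hm, mkC_z₂ k m hm]

/-- The column-1 trace family `(x̄₃, x̄₁)` on `𝒞`. OURS bookkeeping. -/
def tr₁ : Fin 2 → OC k := ![mkC k (X 0), mkC k (X 3)]

/-! ## Chart `x₃` of `Bl_{(x̄₃, x̄₁)} 𝒞`: `≅ k[x₃, c, y₁, t]`, `t = x̄₁/x̄₃`, graph `ȳ₂ = −c̄t`, `d̄ = ȳ₁t` -/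

/-- The chart `B₁ = 𝒪_𝒞[(x̄₃, x̄₁)/x̄₃]`. OURS bookkeeping. -/
abbrev B₁ : Subalgebra (OC k) (Localization.Away (tr₁ k 0)) := blowupAlgebra (Ideal.span (Set.range (tr₁ k))) (tr₁ k 0)

/-- The values of the model coordinates `x₃, c, y₁, t` in `B₁`. OURS bookkeeping. -/
def cv₁ : Fin 4 → B₁ k :=
  ![algebraMap (OC k) (B₁ k) (mkC k (X 0)), algebraMap (OC k) (B₁ k) (mkC k (X 1)), algebraMap (OC k) (B₁ k) (mkC k (X 2)),
    blowupAlgebra.frac (tr₁ k) 0 1]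

/-- **`ψ₁ : k[x₃, c, y₁, t] → B₁`**, `t ↦ x̄₁/x̄₃`. OURS bookkeeping. -/
def ψ₁ : MvPolynomial (Fin 4) k →+* B₁ k :=
  MvPolynomial.eval₂Hom ((algebraMap (OC k) (B₁ k)).comp ((mkC k).comp MvPolynomial.C)) (cv₁ k)

/-- `m₁₂ = 0`: `ȳ₂ x̄₃ = −c̄ x̄₁`. [folklore] -/
theorem y₂_mul_x₃ : mkC k (X 4) * mkC k (X 0) = -(mkC k (X 1) * mkC k (X 3)) := by
  rw [← map_mul, ← map_mul, ← map_neg, Ideal.Quotient.eq]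
  refine Ideal.subset_span (Or.inl ?_)
  rw [m₁₂]; ring

/-- `m₁₃ = 0`: `d̄ x̄₃ = ȳ₁ x̄₁`. [folklore] -/
theorem d_mul_x₃ : mkC k (X 5) * mkC k (X 0) = mkC k (X 2) * mkC k (X 3) := by
  rw [← map_mul, ← map_mul, Ideal.Quotient.eq]
  have h : (X 5 * X 0 - X 2 * X 3 : MvPolynomial (Fin 6) k) = m₁₃ k := by rw [m₁₃]; ring
  rw [h]
  exact Ideal.subset_span (by simp)

/-- `x̄₃ · (1/x̄₃) = 1`. [folklore] -/
theorem x₃_mul_invSelf :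
    algebraMap (OC k) (Localization.Away (tr₁ k 0)) (tr₁ k 0) * IsLocalization.Away.invSelf (tr₁ k 0) = 1 :=
  IsLocalization.Away.mul_invSelf (S := Localization.Away (tr₁ k 0)) (tr₁ k 0)

/-- `ψ₁` on constants. [folklore] -/
theorem ψ₁_C (a : k) : ψ₁ k (C a) = algebraMap (OC k) (B₁ k) (mkC k (C a)) := MvPolynomial.eval₂Hom_C _ _ a
/-- `ψ₁ x₃ = x̄₃`. [folklore] -/
theorem ψ₁_X₀ : ψ₁ k (X 0) = algebraMap (OC k) (B₁ k) (mkC k (X 0)) := MvPolynomial.eval₂Hom_X' _ _ 0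
/-- `ψ₁ c = c̄`. [folklore] -/
theorem ψ₁_X₁ : ψ₁ k (X 1) = algebraMap (OC k) (B₁ k) (mkC k (X 1)) := MvPolynomial.eval₂Hom_X' _ _ 1
/-- `ψ₁ y₁ = ȳ₁`. [folklore] -/
theorem ψ₁_X₂ : ψ₁ k (X 2) = algebraMap (OC k) (B₁ k) (mkC k (X 2)) := MvPolynomial.eval₂Hom_X' _ _ 2
/-- `ψ₁ t = x̄₁/x̄₃`. [folklore] -/
theorem ψ₁_X₃ : ψ₁ k (X 3) = blowupAlgebra.frac (tr₁ k) 0 1 := MvPolynomial.eval₂Hom_X' _ _ 3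

/-- **Graph relation `ȳ₂ = −c̄·t` in `B₁`** (N6.1 (c) «`St(𝒞) = V(y₂ + ct, d − y₁t)`»). [folklore] -/
theorem algebraMap_y₂_eq₁ : algebraMap (OC k) (B₁ k) (mkC k (X 4)) = -(ψ₁ k (X 1) * ψ₁ k (X 3)) := by
  rw [ψ₁_X₁, ψ₁_X₃]
  apply Subtype.ext
  rw [Subalgebra.coe_neg, Subalgebra.coe_mul, blowupAlgebra.coe_frac]
  refine rel_div _ _ _ _ _ (x₃_mul_invSelf k) ?_
  change algebraMap (OC k) (Localization.Away (tr₁ k 0)) (mkC k (X 4)) * algebraMap (OC k) _ (mkC k (X 0)) =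
    -(algebraMap (OC k) _ (mkC k (X 1)) * algebraMap (OC k) _ (mkC k (X 3)))
  rw [← map_mul (algebraMap (OC k) (Localization.Away (tr₁ k 0))), ← map_mul (algebraMap (OC k) (Localization.Away (tr₁ k 0))),
    ← map_neg (algebraMap (OC k) (Localization.Away (tr₁ k 0))), y₂_mul_x₃]

/-- **Graph relation `d̄ = ȳ₁·t` in `B₁`.** [folklore] -/
theorem algebraMap_d_eq₁ : algebraMap (OC k) (B₁ k) (mkC k (X 5)) = ψ₁ k (X 2) * ψ₁ k (X 3) := by
  rw [ψ₁_X₂, ψ₁_X₃]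
  apply Subtype.ext
  rw [Subalgebra.coe_mul, blowupAlgebra.coe_frac]
  refine rel_div' _ _ _ _ _ (x₃_mul_invSelf k) ?_
  change algebraMap (OC k) (Localization.Away (tr₁ k 0)) (mkC k (X 5)) * algebraMap (OC k) _ (mkC k (X 0)) =
    algebraMap (OC k) _ (mkC k (X 2)) * algebraMap (OC k) _ (mkC k (X 3))
  rw [← map_mul (algebraMap (OC k) (Localization.Away (tr₁ k 0))), ← map_mul (algebraMap (OC k) (Localization.Away (tr₁ k 0))),
    d_mul_x₃]

/-- `x̄₁ = x̄₃ · t` in `B₁`. [folklore] -/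
theorem algebraMap_x₁_eq₁ : algebraMap (OC k) (B₁ k) (mkC k (X 3)) = ψ₁ k (X 0) * ψ₁ k (X 3) := by
  rw [ψ₁_X₀, ψ₁_X₃]
  apply Subtype.ext
  rw [Subalgebra.coe_mul, blowupAlgebra.coe_frac]
  exact rel_mul _ _ _ (x₃_mul_invSelf k)

/-- Every `x̄ⱼ` lies in the image of `ψ₁`. [folklore] -/
theorem algebraMap_X_mem_range₁ (j : Fin 6) : algebraMap (OC k) (B₁ k) (mkC k (X j)) ∈ (ψ₁ k).range := by
  match j with
  | ⟨0, _⟩ => exact ⟨X 0, ψ₁_X₀ k⟩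
  | ⟨1, _⟩ => exact ⟨X 1, ψ₁_X₁ k⟩
  | ⟨2, _⟩ => exact ⟨X 2, ψ₁_X₂ k⟩
  | ⟨3, _⟩ =>
    exact (show algebraMap (OC k) (B₁ k) (mkC k (X 3)) ∈ (ψ₁ k).range from
      ⟨X 0 * X 3, by rw [map_mul, ← algebraMap_x₁_eq₁]⟩)
  | ⟨4, _⟩ =>
    exact (show algebraMap (OC k) (B₁ k) (mkC k (X 4)) ∈ (ψ₁ k).range from
      ⟨-(X 1 * X 3), by rw [map_neg, map_mul, ← algebraMap_y₂_eq₁]⟩)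
  | ⟨5, _⟩ =>
    exact (show algebraMap (OC k) (B₁ k) (mkC k (X 5)) ∈ (ψ₁ k).range from
      ⟨X 2 * X 3, by rw [map_mul, ← algebraMap_d_eq₁]⟩)

/-- Every constant lies in the image of `ψ₁`. [folklore] -/
theorem algebraMap_mem_range₁ (y : OC k) : algebraMap (OC k) (B₁ k) y ∈ (ψ₁ k).range := by
  obtain ⟨G, rfl⟩ := Ideal.Quotient.mk_surjective y
  induction G using MvPolynomial.induction_on with
  | C a => exact ⟨C a, ψ₁_C k a⟩
  | add p q hp hq => rw [map_add, map_add]; exact add_mem hp hq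
  | mul_X p j hp => rw [map_mul, map_mul]; exact mul_mem hp (algebraMap_X_mem_range₁ k j)

/-- Every fraction lies in the image of `ψ₁`. [folklore] -/
theorem frac_mem_range₁ (j : Fin 2) : blowupAlgebra.frac (tr₁ k) 0 j ∈ (ψ₁ k).range := by
  have h0 : blowupAlgebra.frac (tr₁ k) 0 0 ∈ (ψ₁ k).range := by
    refine ⟨1, ?_⟩
    rw [map_one]
    apply Subtype.ext
    rw [blowupAlgebra.coe_frac, OneMemClass.coe_one]
    exact (x₃_mul_invSelf k).symm
  match j with
  | ⟨0, _⟩ => exact h0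
  | ⟨1, _⟩ => exact ⟨X 3, ψ₁_X₃ k⟩

/-- **`ψ₁` is onto.** [folklore] -/
theorem ψ₁_surjective : Function.Surjective (ψ₁ k) := by
  intro z
  obtain ⟨F, rfl⟩ := blowupAlgebra.eval_surjective (tr₁ k) 0 z
  suffices h : (blowupAlgebra.eval (tr₁ k) 0 F) ∈ (ψ₁ k).range by exact h
  induction F using MvPolynomial.induction_on with
  | C y => rw [blowupAlgebra.eval_C]; exact algebraMap_mem_range₁ k y
  | add p q hp hq => rw [map_add]; exact add_mem hp hq
  | mul_X p j hp => rw [map_mul, blowupAlgebra.eval_X]; exact mul_mem hp (frac_mem_range₁ k j.1)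

/-- The inverse substitution `x₃ ↦ x₃, c ↦ c, y₁ ↦ y₁, x₁ ↦ x₃t, y₂ ↦ −ct, d ↦ y₁t`. OURS bookkeeping. -/
def lamVal₁ : Fin 6 → MvPolynomial (Fin 4) k := ![X 0, X 1, X 2, X 0 * X 3, -(X 1 * X 3), X 2 * X 3]

/-- `x₃ ↦ x₃`. [folklore] -/
theorem lamVal₁_0 : lamVal₁ k 0 = X 0 := rfl
/-- `c ↦ c`. [folklore] -/
theorem lamVal₁_1 : lamVal₁ k 1 = X 1 := rfl
/-- `y₁ ↦ y₁`. [folklore] -/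
theorem lamVal₁_2 : lamVal₁ k 2 = X 2 := rfl
/-- `x₁ ↦ x₃t`. [folklore] -/
theorem lamVal₁_3 : lamVal₁ k 3 = X 0 * X 3 := rfl
/-- `y₂ ↦ −ct`. [folklore] -/
theorem lamVal₁_4 : lamVal₁ k 4 = -(X 1 * X 3) := rfl
/-- `d ↦ y₁t`. [folklore] -/
theorem lamVal₁_5 : lamVal₁ k 5 = X 2 * X 3 := rfl

/-- The substitution kills the three minors. [folklore] -/
theorem minors_le_ker₁ : minors k ≤ RingHom.ker (MvPolynomial.eval₂Hom MvPolynomial.C (lamVal₁ k)) := by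
  rw [minors, Ideal.span_le]
  rintro F (rfl | rfl | rfl)
  · rw [SetLike.mem_coe, RingHom.mem_ker, m₁₂]
    simp only [map_add, map_mul, MvPolynomial.eval₂Hom_X', lamVal₁_0, lamVal₁_1, lamVal₁_3, lamVal₁_4]
    ring
  · rw [SetLike.mem_coe, RingHom.mem_ker, m₁₃]
    simp only [map_sub, map_mul, MvPolynomial.eval₂Hom_X', lamVal₁_0, lamVal₁_2, lamVal₁_3, lamVal₁_5]
    ring
  · rw [SetLike.mem_coe, RingHom.mem_ker, m₂₃]
    simp only [map_sub, map_neg, map_mul, MvPolynomial.eval₂Hom_X', lamVal₁_1, lamVal₁_2, lamVal₁_4, lamVal₁_5]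
    ring

/-- `λ₁ : 𝒪_𝒞 → k[x₃,c,y₁,t][1/x₃]`. OURS bookkeeping. -/
def lam₁ : OC k →+* Localization.Away (X 0 : MvPolynomial (Fin 4) k) :=
  Ideal.Quotient.lift (minors k)
    ((algebraMap (MvPolynomial (Fin 4) k) (Localization.Away (X 0 : MvPolynomial (Fin 4) k))).comp
      (MvPolynomial.eval₂Hom MvPolynomial.C (lamVal₁ k)))
    (fun a ha => by rw [RingHom.comp_apply, RingHom.mem_ker.mp (minors_le_ker₁ k ha), map_zero])

/-- `λ₁` on classes. [folklore] -/
theorem lam₁_mkC (F : MvPolynomial (Fin 6) k) :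
    lam₁ k (mkC k F) = algebraMap (MvPolynomial (Fin 4) k) (Localization.Away (X 0 : MvPolynomial (Fin 4) k))
      (MvPolynomial.eval₂Hom MvPolynomial.C (lamVal₁ k) F) :=
  Ideal.Quotient.lift_mk _ _ _

/-- `λ₁(x̄₃) = x₃`. [folklore] -/
theorem lam₁_tr_zero : lam₁ k (tr₁ k 0) =
    algebraMap (MvPolynomial (Fin 4) k) (Localization.Away (X 0 : MvPolynomial (Fin 4) k)) (X 0) := by
  change lam₁ k (mkC k (X 0)) = _
  rw [lam₁_mkC, MvPolynomial.eval₂Hom_X', lamVal₁_0]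

/-- `λ₁(x̄₃)` is a unit. [folklore] -/
theorem isUnit_lam₁_tr_zero : IsUnit (lam₁ k (tr₁ k 0)) := by
  rw [lam₁_tr_zero]
  exact IsLocalization.Away.algebraMap_isUnit (X 0 : MvPolynomial (Fin 4) k)

/-- **`Λ₁ : 𝒪_𝒞[1/x̄₃] → k[x₃,c,y₁,t][1/x₃]`**, the left inverse of `ψ₁` after localisation. OURS bookkeeping. -/
def Λ₁ : Localization.Away (tr₁ k 0) →+* Localization.Away (X 0 : MvPolynomial (Fin 4) k) :=
  IsLocalization.Away.lift (tr₁ k 0) (isUnit_lam₁_tr_zero k)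

/-- `Λ₁` extends `λ₁`. [folklore] -/
theorem Λ₁_algebraMap (y : OC k) : Λ₁ k (algebraMap (OC k) (Localization.Away (tr₁ k 0)) y) = lam₁ k y :=
  IsLocalization.Away.lift_eq (tr₁ k 0) (isUnit_lam₁_tr_zero k) y

/-- `Λ₁` on a fraction. [folklore] -/
theorem Λ₁_frac {r : OC k} {t : Localization.Away (X 0 : MvPolynomial (Fin 4) k)} (h : lam₁ k r = t * lam₁ k (tr₁ k 0)) :
    Λ₁ k (algebraMap (OC k) (Localization.Away (tr₁ k 0)) r * IsLocalization.Away.invSelf (tr₁ k 0)) = t := by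
  refine (isUnit_lam₁_tr_zero k).mul_left_injective ?_
  dsimp only
  rw [← h, ← Λ₁_algebraMap k (tr₁ k 0), ← map_mul, mul_assoc, mul_comm (IsLocalization.Away.invSelf (tr₁ k 0)),
    x₃_mul_invSelf, mul_one, Λ₁_algebraMap]

/-- **`Λ₁ ∘ ψ₁ = (k[x₃,c,y₁,t] → k[x₃,c,y₁,t][1/x₃])`.** [folklore] -/
theorem Λ₁_comp_ψ₁ :
    (Λ₁ k).comp (((B₁ k).val : B₁ k →+* Localization.Away (tr₁ k 0)).comp (ψ₁ k)) =
      algebraMap (MvPolynomial (Fin 4) k) (Localization.Away (X 0 : MvPolynomial (Fin 4) k)) := by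
  refine MvPolynomial.ringHom_ext (fun a => ?_) (fun j => ?_)
  · rw [RingHom.comp_apply, RingHom.comp_apply, ψ₁_C]
    change Λ₁ k (algebraMap (OC k) (Localization.Away (tr₁ k 0)) (mkC k (C a))) = _
    rw [Λ₁_algebraMap, lam₁_mkC, MvPolynomial.eval₂Hom_C]
  · rw [RingHom.comp_apply, RingHom.comp_apply]
    match j with
    | ⟨0, _⟩ =>
      change Λ₁ k ((ψ₁ k (X 0) : B₁ k) : Localization.Away (tr₁ k 0)) = algebraMap _ _ (X 0)
      rw [ψ₁_X₀]
      change Λ₁ k (algebraMap (OC k) (Localization.Away (tr₁ k 0)) (mkC k (X 0))) = _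
      rw [Λ₁_algebraMap, lam₁_mkC, MvPolynomial.eval₂Hom_X']
      rfl
    | ⟨1, _⟩ =>
      change Λ₁ k ((ψ₁ k (X 1) : B₁ k) : Localization.Away (tr₁ k 0)) = algebraMap _ _ (X 1)
      rw [ψ₁_X₁]
      change Λ₁ k (algebraMap (OC k) (Localization.Away (tr₁ k 0)) (mkC k (X 1))) = _
      rw [Λ₁_algebraMap, lam₁_mkC, MvPolynomial.eval₂Hom_X']
      rfl
    | ⟨2, _⟩ =>
      change Λ₁ k ((ψ₁ k (X 2) : B₁ k) : Localization.Away (tr₁ k 0)) = algebraMap _ _ (X 2)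
      rw [ψ₁_X₂]
      change Λ₁ k (algebraMap (OC k) (Localization.Away (tr₁ k 0)) (mkC k (X 2))) = _
      rw [Λ₁_algebraMap, lam₁_mkC, MvPolynomial.eval₂Hom_X']
      rfl
    | ⟨3, _⟩ =>
      change Λ₁ k ((ψ₁ k (X 3) : B₁ k) : Localization.Away (tr₁ k 0)) = algebraMap _ _ (X 3)
      rw [ψ₁_X₃, blowupAlgebra.coe_frac]
      refine Λ₁_frac k ?_
      change lam₁ k (mkC k (X 3)) = _
      rw [lam₁_tr_zero, lam₁_mkC, MvPolynomial.eval₂Hom_X', ← map_mul, lamVal₁_3, mul_comm]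

/-- **`ψ₁` is injective** (`k` a domain). [folklore] -/
theorem ψ₁_injective [IsDomain k] : Function.Injective (ψ₁ k) := by
  have hinj : Function.Injective
      (algebraMap (MvPolynomial (Fin 4) k) (Localization.Away (X 0 : MvPolynomial (Fin 4) k))) :=
    IsLocalization.injective _ (powers_le_nonZeroDivisors_of_noZeroDivisors (MvPolynomial.X_ne_zero 0))
  rw [← Λ₁_comp_ψ₁, RingHom.coe_comp, RingHom.coe_comp] at hinj
  exact hinj.of_comp.of_comp

/-- **RIBBON EXIT, chart `x₃` (N6.1 (c), model form): `ψ₁ : k[x₃, c, y₁, t] → 𝒪_𝒞[(x̄₃,x̄₁)/x̄₃]` is a bijection** — blowing up the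
(reduced) trace `(x̄₃, x̄₁)` of the ribbon centres `Z_m` is the other small resolution of the vertex; graph `ȳ₂ = −c̄t`, `d̄ = ȳ₁t`. OURS. -/
theorem ψ₁_bijective [IsDomain k] : Function.Bijective (ψ₁ k) :=
  ⟨ψ₁_injective k, ψ₁_surjective k⟩

/-- **The chart `𝒪_𝒞[(x̄₃,x̄₁)/x̄₃]` is a regular ring** (over a field). OURS. -/
theorem isRegularRing_B₁ (K : Type u) [Field K] : IsRegularRing (B₁ K) :=
  IsRegularRing.of_ringEquiv (RingEquiv.ofBijective (ψ₁ K) (ψ₁_bijective K))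

end VertexExit

end Summit.ResolutionOfSingularities.ResolutionOfSingularities.Cruxes.EquisingularLiftNat.Sections
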